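import Literature.Probability.LatticeModels.CoarseCellMixingDefectsClusterReach
import Literature.Probability.LatticeModels.CoarseCellMixingPeierls
import Literature.Probability.LatticeModels.LatticeAnimals
import Mathlib.Analysis.SpecificLimits.Basic
import HarnessLib

/-!
# Coarse-cell mixing with defects: bad clusters reaching far are improbable (chain counting)

Companion ("theorems only") file of the coarse-cell defect series. In the expansion around the
bad cluster attached to a seed `Sd` (linking range `1`), cluster shapes that leave a "safe" set of
cells `U` (the cells far from the sources) are not expanded further; their total kernel probability
is bounded directly: if the bad cluster of `σ` leaves `U`, then some seed cell `s` is joined, inside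
`U`, by a connected set `T` of bad cells to a cell adjacent to the complement of `U`
(`exists_connected_bad_of_badCluster_not_subset`); such a `T` has at least `m + 1` cells when the
seed is at coarse distance `≥ m` from the cells adjacent to `Uᶜ` (`card_ge_of_connected`, discrete
intermediate values of `cdist s ·` along a chain); by the kernel-uniform Peierls bound and the
lattice-animal count (`LatticeAnimals.card_connectedFamily_le`, at most `(3^d+1)^{2k}` connected
sets of `k+1` cells through a point) the kernel probability of the far event is at most
`|Sd| · 2q ((3^d+1)^2 q)^m` once `(3^d+1)^2 q ≤ 1/2` (`measureReal_farEvent_le`).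

## References

* S. Friedli, Y. Velenik, *Statistical Mechanics of Lattice Systems* (CUP 2017), §3.7.2, §5.7
  (Peierls estimates, animal counting).
* J. van den Berg, C. Maes, Ann. Probab. 22 (1994), §2.
-/

noncomputable section

open _root_.MeasureTheory
open scoped ENNReal

namespace Literature.Probability.LatticeModels

variable {d : ℕ} {μc : Fin d → ℕ}

/-! ### Connected sets of cells through a point -/

section Connected

/-- `T` is connected from `s` by steps of coarse length `≤ 1` inside `T`. [folklore] -/
def IsCellConnectedFrom (s : CoarseIdx μc) (T : Finset (CoarseIdx μc)) : Prop :=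
  ∀ w ∈ T, Relation.ReflTransGen (fun x y : CoarseIdx μc => cdist x y ≤ 1 ∧ x ∈ T ∧ y ∈ T) s w

/-- The singleton `{s}` is connected from `s`. [folklore] -/
theorem isCellConnectedFrom_singleton (s : CoarseIdx μc) : IsCellConnectedFrom s {s} := by
  intro w hw
  rw [Finset.mem_singleton] at hw
  subst hw
  exact Relation.ReflTransGen.refl

/-- Adding a cell adjacent to a cell of `T` keeps connectedness from `s`. [folklore] -/
theorem isCellConnectedFrom_insert [DecidableEq (CoarseIdx μc)] {s : CoarseIdx μc}
    {T : Finset (CoarseIdx μc)} (hT : IsCellConnectedFrom s T) {b c : CoarseIdx μc} (hb : b ∈ T)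
    (hbc : cdist b c ≤ 1) : IsCellConnectedFrom s (insert c T) := by
  intro w hw
  have hle : (fun x y : CoarseIdx μc => cdist x y ≤ 1 ∧ x ∈ T ∧ y ∈ T) ≤
      (fun x y : CoarseIdx μc => cdist x y ≤ 1 ∧ x ∈ insert c T ∧ y ∈ insert c T) :=
    fun x y h => ⟨h.1, Finset.mem_insert_of_mem h.2.1, Finset.mem_insert_of_mem h.2.2⟩
  have hlift : ∀ w ∈ T, Relation.ReflTransGen
      (fun x y : CoarseIdx μc => cdist x y ≤ 1 ∧ x ∈ insert c T ∧ y ∈ insert c T) s w :=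
    fun w hw => Relation.ReflTransGen.mono hle s w (hT w hw)
  rcases Finset.mem_insert.1 hw with rfl | hw'
  · exact (hlift b hb).tail ⟨hbc, Finset.mem_insert_of_mem hb, Finset.mem_insert_self _ _⟩
  · exact hlift w hw'

/-- **Discrete intermediate values**: along a chain from `s` to `w` inside `T` the coarse distance
to `s` takes every value `j ≤ cdist s w` on `T`. [folklore] -/
theorem exists_mem_cdist_eq_of_reflTransGen {s w : CoarseIdx μc} {T : Finset (CoarseIdx μc)}
    (h : Relation.ReflTransGen (fun x y : CoarseIdx μc => cdist x y ≤ 1 ∧ x ∈ T ∧ y ∈ T) s w)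
    (hs : s ∈ T) : ∀ j, j ≤ cdist s w → ∃ x ∈ T, cdist s x = j := by
  induction h with
  | refl =>
    intro j hj
    rw [cdist_self] at hj
    exact ⟨s, hs, by rw [cdist_self]; omega⟩
  | @tail b c _ hbc ih =>
    intro j hj
    by_cases hjb : j ≤ cdist s b
    · exact ih j hjb
    · have h1 : cdist s c ≤ cdist s b + cdist b c := cdist_triangle _ _ _
      refine ⟨c, hbc.2.2, ?_⟩
      omega

/-- **A connected set joining `s` to a cell at distance `≥ m` has at least `m + 1` cells.**
[folklore] -/
theorem card_ge_of_connected {s w : CoarseIdx μc} {T : Finset (CoarseIdx μc)}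
    (hT : IsCellConnectedFrom s T) (hs : s ∈ T) (hw : w ∈ T) {m : ℕ} (hm : m ≤ cdist s w) :
    m + 1 ≤ T.card := by
  classical
  have hsub : Finset.range (m + 1) ⊆ T.image fun x => cdist s x := by
    intro j hj
    rw [Finset.mem_range] at hj
    obtain ⟨x, hx, hxj⟩ := exists_mem_cdist_eq_of_reflTransGen (hT w hw) hs j (by omega)
    exact Finset.mem_image.2 ⟨x, hx, hxj⟩
  calc m + 1 = (Finset.range (m + 1)).card := (Finset.card_range _).symm
    _ ≤ (T.image fun x => cdist s x).card := Finset.card_le_card hsub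
    _ ≤ T.card := Finset.card_image_le

/-- **Counting connected cell sets through a point**: a finite family of sets `T`, each containing
`s`, connected from `s` and of cardinality `≤ k + 1`, has at most `(3^d + 1)^{2k}` members
(`LatticeAnimals.card_connectedFamily_le` with the `3^d` cells at coarse distance `≤ 1`).
[cite: FriedliVelenik2017, Lemma 3.38 and eq. (5.27)] -/
theorem card_connectedCellFamily_le (s : CoarseIdx μc) (k : ℕ) (𝒯 : Finset (Finset (CoarseIdx μc)))
    (h𝒯 : ∀ T ∈ 𝒯, s ∈ T ∧ T.card ≤ k + 1 ∧ IsCellConnectedFrom s T) :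
    𝒯.card ≤ (3 ^ d + 1) ^ (2 * k) := by
  classical
  refine card_connectedFamily_le (R := fun x y : CoarseIdx μc => cdist x y ≤ 1)
    (nbr := fun x => Finset.univ.filter fun y : CoarseIdx μc => cdist x y ≤ 1)
    (fun x y h => by rwa [cdist_comm]) (fun x => ?_) (fun x y h => ?_) s k 𝒯 h𝒯
  · have h := card_filter_cdist_le x 1
    norm_num at h
    exact h
  · exact Finset.mem_filter.2 ⟨Finset.mem_univ _, h⟩

end Connected

/-! ### The far event -/

section Far

variable {V S : Type*}

/-- **If the bad cluster leaves the safe set, a connected bad set inside it reaches its edge.**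
If the bad cluster of `σ` attached to `Sd ⊆ U` (linking range `1`, all cells) contains a cell
outside `U`, then some seed cell `s` lies in a set `T ⊆ U` of bad cells, connected from `s`, one
of whose cells is within coarse distance `1` of a cell outside `U` (follow a linking chain from
the seed inside the cluster up to its first exit from `U`). [folklore] -/
theorem exists_connected_bad_of_badCluster_not_subset (good : CoarseIdx μc → Set (V → S))
    {U Sd : Finset (CoarseIdx μc)} (hSdU : Sd ⊆ U) {σ : V → S}
    (h : ¬ badCluster good 1 Finset.univ Sd σ ⊆ U) :
    ∃ s ∈ Sd, ∃ T : Finset (CoarseIdx μc), s ∈ T ∧ T ⊆ U ∧ (∀ t ∈ T, σ ∉ good t) ∧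
      IsCellConnectedFrom s T ∧ ∃ t ∈ T, ∃ c, c ∉ U ∧ cdist t c ≤ 1 := by
  classical
  set B : Finset (CoarseIdx μc) := badCluster good 1 Finset.univ Sd σ with hB
  obtain ⟨c, hcB, hcU⟩ := Finset.not_subset.1 h
  have hbad : ∀ b ∈ B, σ ∉ good b := fun b hb => by
    have := badCluster_subset good 1 Finset.univ Sd σ hb
    exact (Finset.mem_filter.1 this).2
  obtain ⟨s, hsSd, hsB, hchain⟩ := seedClosure_connected (adj := fun x y : CoarseIdx μc =>
    cdist x y ≤ 1) (B := Finset.univ.filter fun c => σ ∉ good c) (S := Sd) (by exact hcB)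
  -- invariant along the chain
  have key : ∀ w, Relation.ReflTransGen
      (fun x y : CoarseIdx μc => (cdist x y ≤ 1) ∧ x ∈ B ∧ y ∈ B) s w →
      (∃ T : Finset (CoarseIdx μc), s ∈ T ∧ T ⊆ U ∧ T ⊆ B ∧ IsCellConnectedFrom s T ∧
          ∃ t ∈ T, ∃ c, c ∉ U ∧ cdist t c ≤ 1) ∨
        (w ∈ U ∧ ∃ T : Finset (CoarseIdx μc), s ∈ T ∧ T ⊆ U ∧ T ⊆ B ∧ w ∈ T ∧
          IsCellConnectedFrom s T) := by
    intro w hw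
    induction hw with
    | refl =>
      right
      refine ⟨hSdU hsSd, {s}, Finset.mem_singleton_self _, ?_, ?_, Finset.mem_singleton_self _,
        isCellConnectedFrom_singleton s⟩
      · exact Finset.singleton_subset_iff.2 (hSdU hsSd)
      · exact Finset.singleton_subset_iff.2 hsB
    | @tail b c' _ hbc ih =>
      rcases ih with hexit | ⟨hbU, T, hsT, hTU, hTB, hbT, hconn⟩
      · exact Or.inl hexit
      · by_cases hc'U : c' ∈ U
        · right
          refine ⟨hc'U, insert c' T, Finset.mem_insert_of_mem hsT, ?_, ?_,
            Finset.mem_insert_self _ _, isCellConnectedFrom_insert hconn hbT hbc.1⟩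
          · exact Finset.insert_subset hc'U hTU
          · exact Finset.insert_subset hbc.2.2 hTB
        · left
          exact ⟨T, hsT, hTU, hTB, hconn, b, hbT, c', hc'U, hbc.1⟩
  rcases key c hchain with ⟨T, hsT, hTU, hTB, hconn, hexit⟩ | ⟨hcU', -⟩
  · exact ⟨s, hsSd, T, hsT, hTU, fun t ht => hbad t (hTB ht), hconn, hexit⟩
  · exact absurd hcU' hcU

variable [MeasurableSpace S]

/-- **Kernel probability of the far event.** Let `γ` satisfy the kernel-uniform Peierls bound at
level `q` with `(3^d+1)^2 q ≤ 1/2`, `Λ` a cell-union volume, `η` an exterior such that every cell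
within coarse distance `1` of `U` is a `Λ`-cell or good in `η`, `Sd ⊆ U` a seed whose cells are at
coarse distance `≥ m` from every cell adjacent to the complement of `U`. Then the kernel
probability that the bad cluster attached to `Sd` leaves `U` is at most
`|Sd| · 2 q ((3^d+1)^2 q)^m`. [folklore] -/
theorem measureReal_farEvent_le [Fintype V] {cell : V → CoarseIdx μc}
    {γ : Specification V S} (hγ : IsSpecification γ) {good : CoarseIdx μc → Set (V → S)}
    {q : ℝ} (hq : 0 ≤ q)
    (hq2 : ((3 : ℝ) ^ d + 1) ^ 2 * q ≤ 1 / 2) (hUKP : UniformKernelPeierls cell γ good q)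
    (Λ : Finset V) (hΛ : ∀ v w, cell v = cell w → v ∈ Λ → w ∈ Λ) (η : V → S)
    (U Sd : Finset (CoarseIdx μc)) (hSdU : Sd ⊆ U)
    (hU : ∀ c ∈ U, ∀ c' : CoarseIdx μc, cdist c c' ≤ 1 → (∀ v, cell v = c' → v ∈ Λ) ∨ η ∈ good c')
    {m : ℕ} (hm : ∀ s ∈ Sd, ∀ t : CoarseIdx μc, (∃ c, c ∉ U ∧ cdist t c ≤ 1) → m ≤ cdist s t) :
    (γ Λ η).real {σ | ¬ badCluster good 1 Finset.univ Sd σ ⊆ U} ≤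
      Sd.card * (2 * q * (((3 : ℝ) ^ d + 1) ^ 2 * q) ^ m) := by
  classical
  haveI := hγ.isProbability Λ η
  -- the family of connected bad-able sets through a seed cell reaching the edge of `U`
  let 𝒯 : CoarseIdx μc → Finset (Finset (CoarseIdx μc)) := fun s =>
    Finset.univ.powerset.filter fun T => s ∈ T ∧ T ⊆ U ∧ IsCellConnectedFrom s T ∧
      ∃ t ∈ T, ∃ c, c ∉ U ∧ cdist t c ≤ 1
  have hcover : {σ : V → S | ¬ badCluster good 1 Finset.univ Sd σ ⊆ U} ⊆
      ⋃ s ∈ Sd, ⋃ T ∈ 𝒯 s, {σ | ∀ t ∈ T, σ ∉ good t} := by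
    intro σ hσ
    obtain ⟨s, hs, T, hsT, hTU, hTbad, hconn, hexit⟩ :=
      exists_connected_bad_of_badCluster_not_subset good hSdU hσ
    simp only [Set.mem_iUnion, Set.mem_setOf_eq]
    refine ⟨s, hs, T, ?_, hTbad⟩
    exact Finset.mem_filter.2 ⟨Finset.mem_powerset.2 (Finset.subset_univ _), hsT, hTU, hconn, hexit⟩
  -- Peierls on each member
  have hPeierls : ∀ s ∈ Sd, ∀ T ∈ 𝒯 s, (γ Λ η).real {σ | ∀ t ∈ T, σ ∉ good t} ≤ q ^ T.card := by
    intro s _ T hT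
    obtain ⟨-, -, hTU, -, -⟩ := Finset.mem_filter.1 hT
    have h := hUKP Λ hΛ η T fun c hc c' hcc' => hU c (hTU hc) c' hcc'
    exact ENNReal.toReal_le_of_le_ofReal (by positivity) h
  -- cardinality of the members is at least `m + 1`
  have hcard : ∀ s ∈ Sd, ∀ T ∈ 𝒯 s, m + 1 ≤ T.card := by
    intro s hs T hT
    obtain ⟨-, hsT, -, hconn, t, ht, c, hcU, htc⟩ := Finset.mem_filter.1 hT
    exact card_ge_of_connected hconn hsT ht (hm s hs t ⟨c, hcU, htc⟩)
  -- the sum over the family for one seed cell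
  set x : ℝ := ((3 : ℝ) ^ d + 1) ^ 2 * q with hx
  have hx0 : 0 ≤ x := by positivity
  have hx1 : x ≤ 1 / 2 := hq2
  have hq1 : q ≤ 1 := by
    have h1 : (1 : ℝ) ≤ ((3 : ℝ) ^ d + 1) ^ 2 := one_le_pow₀ (by
      have : (0 : ℝ) ≤ 3 ^ d := by positivity
      linarith)
    nlinarith
  have hsum : ∀ s ∈ Sd, ∑ T ∈ 𝒯 s, q ^ T.card ≤ 2 * q * x ^ m := by
    intro s hs
    -- group by cardinality `k + 1`, `k ≥ m`
    set N : ℕ := Fintype.card (CoarseIdx μc) with hN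
    have hsplit : ∑ T ∈ 𝒯 s, q ^ T.card =
        ∑ k ∈ Finset.range (N + 1), ∑ T ∈ (𝒯 s).filter (fun T => T.card = k + 1), q ^ T.card := by
      rw [← Finset.sum_biUnion]
      · apply Finset.sum_congr _ fun _ _ => rfl
        ext T
        simp only [Finset.mem_biUnion, Finset.mem_range, Finset.mem_filter]
        constructor
        · intro hT
          have h1 := hcard s hs T hT
          have h2 : T.card ≤ N := by
            rw [hN, ← Finset.card_univ]; exact Finset.card_le_card (Finset.subset_univ _)
          exact ⟨T.card - 1, by omega, hT, by omega⟩
        · rintro ⟨k, -, hT, -⟩; exact hT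
      · intro k _ k' _ hkk'
        simp only [Function.onFun]
        rw [Finset.disjoint_left]
        intro T hT hT'
        rw [Finset.mem_filter] at hT hT'
        omega
    rw [hsplit]
    have hterm : ∀ k ∈ Finset.range (N + 1),
        ∑ T ∈ (𝒯 s).filter (fun T => T.card = k + 1), q ^ T.card ≤
          if m ≤ k then ((3 : ℝ) ^ d + 1) ^ (2 * k) * q ^ (k + 1) else 0 := by
      intro k _
      split_ifs with hmk
      · have hc : ((𝒯 s).filter (fun T => T.card = k + 1)).card ≤ (3 ^ d + 1) ^ (2 * k) := by
          refine card_connectedCellFamily_le s k _ fun T hT => ?_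
          obtain ⟨hT, hTk⟩ := Finset.mem_filter.1 hT
          obtain ⟨-, hsT, -, hconn, -⟩ := Finset.mem_filter.1 hT
          exact ⟨hsT, hTk.le, hconn⟩
        calc ∑ T ∈ (𝒯 s).filter (fun T => T.card = k + 1), q ^ T.card
            = ∑ T ∈ (𝒯 s).filter (fun T => T.card = k + 1), q ^ (k + 1) :=
              Finset.sum_congr rfl fun T hT => by rw [(Finset.mem_filter.1 hT).2]
          _ = ((𝒯 s).filter (fun T => T.card = k + 1)).card * q ^ (k + 1) := by
              rw [Finset.sum_const, nsmul_eq_mul]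
          _ ≤ ((3 : ℝ) ^ d + 1) ^ (2 * k) * q ^ (k + 1) := by
              refine mul_le_mul_of_nonneg_right ?_ (by positivity)
              exact_mod_cast hc
      · have hempty : (𝒯 s).filter (fun T => T.card = k + 1) = ∅ := by
          rw [Finset.filter_eq_empty_iff]
          intro T hT hTk
          have := hcard s hs T hT
          omega
        rw [hempty, Finset.sum_empty]
    refine (Finset.sum_le_sum hterm).trans ?_
    -- geometric tail
    have hgeom : ∑ k ∈ Finset.range (N + 1),
        (if m ≤ k then ((3 : ℝ) ^ d + 1) ^ (2 * k) * q ^ (k + 1) else 0) ≤ 2 * q * x ^ m := by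
      have hre : ∀ k, ((3 : ℝ) ^ d + 1) ^ (2 * k) * q ^ (k + 1) = q * x ^ k := fun k => by
        rw [hx, mul_pow, ← pow_mul, pow_succ]; ring
      simp_rw [hre]
      rw [← Finset.sum_filter]
      have hfil : (Finset.range (N + 1)).filter (fun k => m ≤ k) = Finset.Ico m (N + 1) := by
        ext k
        simp only [Finset.mem_filter, Finset.mem_range, Finset.mem_Ico]
        omega
      rw [hfil, ← Finset.mul_sum]
      have hlt : x < 1 := by linarith
      have hg := geom_sum_Ico_le_of_lt_one (m := m) (n := N + 1) hx0 hlt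
      calc q * ∑ k ∈ Finset.Ico m (N + 1), x ^ k ≤ q * (x ^ m / (1 - x)) :=
            mul_le_mul_of_nonneg_left hg hq
        _ ≤ q * (x ^ m * 2) := by
            refine mul_le_mul_of_nonneg_left ?_ hq
            rw [div_le_iff₀ (by linarith)]
            nlinarith [pow_nonneg hx0 m]
        _ = 2 * q * x ^ m := by ring
    exact hgeom
  -- assemble: union bound
  calc (γ Λ η).real {σ | ¬ badCluster good 1 Finset.univ Sd σ ⊆ U}
      ≤ (γ Λ η).real (⋃ s ∈ Sd, ⋃ T ∈ 𝒯 s, {σ | ∀ t ∈ T, σ ∉ good t}) :=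
        measureReal_mono hcover (measure_ne_top _ _)
    _ ≤ ∑ s ∈ Sd, (γ Λ η).real (⋃ T ∈ 𝒯 s, {σ | ∀ t ∈ T, σ ∉ good t}) :=
        measureReal_biUnion_finset_le _ _
    _ ≤ ∑ s ∈ Sd, ∑ T ∈ 𝒯 s, (γ Λ η).real {σ | ∀ t ∈ T, σ ∉ good t} :=
        Finset.sum_le_sum fun s _ => measureReal_biUnion_finset_le _ _
    _ ≤ ∑ s ∈ Sd, ∑ T ∈ 𝒯 s, q ^ T.card :=
        Finset.sum_le_sum fun s hs => Finset.sum_le_sum fun T hT => hPeierls s hs T hT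
    _ ≤ ∑ _s ∈ Sd, 2 * q * x ^ m := Finset.sum_le_sum hsum
    _ = Sd.card * (2 * q * x ^ m) := by rw [Finset.sum_const, nsmul_eq_mul]

end Far

end Literature.Probability.LatticeModels
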